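import Summits.SmoothPoincare4.SmoothPoincare4.Theorems.SymplecticOrigamiOrigamiFoldExistenceHelperDarbouxBallSphereProdFour
import Summits.SmoothPoincare4.SmoothPoincare4.Theorems.SymplecticOrigamiOrigamiFoldExistenceHelperAntipodalChartPair
import Summits.SmoothPoincare4.SmoothPoincare4.Theorems.SymplecticOrigamiOrigamiFoldExistenceHelperIsStabilisingRoundContactSphere
import Literature.Topology.FourManifolds.HomotopySpheres
import Literature.Topology.FourManifolds.HomotopyS4OrientableProofs
import Literature.Geometry.Kaehler.ComplexProjectiveSpaceFubiniStudy

/-!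
# Helper `helper_stableSeamHypotheses_inhabited` of line `stable-seam-host` for crux
`OrigamiFoldExistence` (item stmt-SmoothPoincare4-7844, route route-SmoothPoincare4-SymplecticOrigami;
registry v2, lead c10, wave 1)

**NON-VACUITY of the hypothesis package of STUB 3 v2 (`stub_stableSeamRigidity`) at `S = S⁴`.**
STUB 3 v2 says: if the fake ball of a homotopy 4-sphere `S` (the complement of a chart ball
`e : ℝ⁴ ↪ S`) sits, through an embedding `J` of a neighbourhood, in a closed simply connected
RATIONAL symplectic host `(X, Ω)` so that the seam `J ∘ e|_{S³}` is `Ω`-STABLE (Cieliebak–Volkov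
clauses for a stabilising 1-form `θ`), then `S ≅ S⁴`.  The standing disprover audits such stubs for
vacuity (an inconsistent hypothesis package would make STUB 3 provable and silently move all weight
to `stub_stableRepresentative`).  This file certifies in the kernel, for the exact typed clauses,
that the package is inhabited by the "known rung" of the line — the round contact seam of a GENUINE
ball in `(S² × S², σ ⊕ σ)`:

* `S = S⁴` (Mathlib's round sphere, oriented by the tree's
  `isOrientable_of_homotopyEquiv_sphere_four_holds`), `e = (chartAt q)⁻¹` its genuine chart ball
  (`helper_antipodalChartPair`, p156659);
* `(X, Ω) = (SphereProdFour, σ ⊕ σ)`, the `ℝ⁴`-charted `S² × S²` with its square-zero symplectic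
  sphere pair (`Literature.Geometry.Symplectic.sphereProdFour_hostPackage`) — the first disjunct of
  `IsRationalHost`;
* `J = G ∘ π`, where `G : B⁴(2) → S² × S²` is the symplectic Darboux ball built from two Archimedes
  equal-area charts (`helper_darbouxBall_sphereProdFour`, p156433; `helper_archimedesMap`, p155661)
  and `π = ¼ • chartAt (-q)` the rescaled antipodal chart: `J` is `C^∞`, injective and immersive
  on an open `U ⊇ S⁴ ∖ e(B⁴)` (`EmbedsFakeBallNhd`);
* the seam: on the unit sphere `π ∘ e = L` (a linear isometry of `ℝ⁴`, the transition of the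
  stereographic atlas being the inversion, whose differential on `S³` is the reflection in `u^⊥`),
  so `Ω((J ∘ e) u)(d(J ∘ e) v, d(J ∘ e) w) = ω₀(L v, L w)` for `v, w ⊥ u` — the round contact trace
  transported by `L` — and `θ(u) = ½ ω₀(L u, L ·)` stabilises it: clause (i) is the round clause of
  `helper_isStabilising_roundContactSphere` (p141283) at the frame `(L u; L v₀, L v₁, L v₂)`,
  clause (ii) is `dθ = ω₀(L ·, L ·)` and antisymmetry.

This is also the `S⁴`-instance of the conclusion shape of `stub_stableRepresentative`.
No definitions, no named facts, no `sorry`.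

Sources: K. Cieliebak, E. Volkov, *First steps in stable Hamiltonian topology*, JEMS 17 (2015), §1;
D. McDuff, D. Salamon, *Introduction to Symplectic Topology*, 3rd ed. (2017), §3.1, Ex. 3.1.2,
Ex. 10.4.2 (iii); Hirsch, *Differential Topology* (1976), §1.1.
-/

noncomputable section

-- the prescribed namespace `Summit.<P>.<Sub>.…` duplicates `SmoothPoincare4` (P = Sub)
set_option linter.dupNamespace false

open scoped Manifold ContDiff Topology RealInnerProductSpace
open Set Function Metric
open Literature.Geometry.Symplectic Literature.Geometry.Kaehler Literature.Topology.FourManifolds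

namespace Summit.SmoothPoincare4.SmoothPoincare4.Theorems.OrigamiFoldExistence.StableSeamHost

/-! ### Transfer of the round contact stabiliser along a linear isometry -/

/-- The transported contact form `θ_L(u)(v) = ½ ω₀(L u, L v)` as a continuous bilinear map (an
existence, so that no definition is added). [folklore] -/
private theorem exists_clm_theta (L : EuclideanSpace ℝ (Fin 4) ≃ₗᵢ[ℝ] EuclideanSpace ℝ (Fin 4)) :
    ∃ B : EuclideanSpace ℝ (Fin 4) →L[ℝ] EuclideanSpace ℝ (Fin 4) →L[ℝ] ℝ,
      ∀ u v, B u v = 2⁻¹ * stdSymplecticForm (L u) (L v) := by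
  obtain ⟨B₀, hB₀⟩ := exists_clm_stdSymplecticForm
  refine ⟨((2⁻¹ : ℝ) • B₀).bilinearComp L.toContinuousLinearEquiv.toContinuousLinearMap
    L.toContinuousLinearEquiv.toContinuousLinearMap, fun u v => ?_⟩
  simp [hB₀]

/-- **The stabilising clauses transfer along a linear isometry `L` of `ℝ⁴`**: if a seam trace `σ`
satisfies `σ(u)(v, w) = ω₀(L v, L w)` for `‖u‖ = 1` and `v, w ⊥ u`, then `θ_L(u) = ½ ω₀(L u, L ·)`
stabilises it — clause (i) is the round contact clause (`helper_isStabilising_roundContactSphere`)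
at the frame `(L u; L v₀, L v₁, L v₂)`, clause (ii) is `dθ_L = ω₀(L ·, L ·)` and antisymmetry.
[folklore] -/
private theorem isStabilising_transfer (L : EuclideanSpace ℝ (Fin 4) ≃ₗᵢ[ℝ] EuclideanSpace ℝ (Fin 4))
    {σ : EuclideanSpace ℝ (Fin 4) → EuclideanSpace ℝ (Fin 4) → EuclideanSpace ℝ (Fin 4) → ℝ}
    (hσ : ∀ u : EuclideanSpace ℝ (Fin 4), ‖u‖ = 1 → ∀ v w : EuclideanSpace ℝ (Fin 4), ⟪v, u⟫ = 0 →
      ⟪w, u⟫ = 0 → σ u v w = stdSymplecticForm (L v) (L w)) :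
    ∃ θ : EuclideanSpace ℝ (Fin 4) → EuclideanSpace ℝ (Fin 4) →L[ℝ] ℝ, ContDiff ℝ ∞ θ ∧
      (∀ u : EuclideanSpace ℝ (Fin 4), ‖u‖ = 1 → ∀ v : Fin 3 → EuclideanSpace ℝ (Fin 4),
        (∀ i, ⟪v i, u⟫ = 0) → LinearIndependent ℝ v →
          θ u (v 0) * σ u (v 1) (v 2) - θ u (v 1) * σ u (v 0) (v 2) +
            θ u (v 2) * σ u (v 0) (v 1) ≠ 0) ∧
      (∀ u : EuclideanSpace ℝ (Fin 4), ‖u‖ = 1 → ∀ v : EuclideanSpace ℝ (Fin 4), ⟪v, u⟫ = 0 →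
        (∀ w : EuclideanSpace ℝ (Fin 4), ⟪w, u⟫ = 0 → σ u v w = 0) →
          ∀ w : EuclideanSpace ℝ (Fin 4), ⟪w, u⟫ = 0 → fderiv ℝ θ u v w - fderiv ℝ θ u w v = 0) := by
  obtain ⟨B, hB⟩ := exists_clm_theta L
  obtain ⟨θ₀, hθ₀, -, h₀, -⟩ := helper_isStabilising_roundContactSphere
  refine ⟨⇑B, B.contDiff, ?_, ?_⟩
  · intro u hu v hvu hv
    have hLu : ‖L u‖ = 1 := by rw [L.norm_map, hu]
    have hLvu : ∀ i, ⟪(⇑L ∘ v) i, L u⟫ = 0 := fun i => by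
      rw [Function.comp_apply, L.inner_map_map, hvu i]
    have hLv : LinearIndependent ℝ (⇑L ∘ v) :=
      hv.map' L.toLinearEquiv.toLinearMap L.toLinearEquiv.ker
    have h := h₀ (L u) hLu (⇑L ∘ v) hLvu hLv
    simp only [Function.comp_apply, hθ₀] at h
    rw [hσ u hu _ _ (hvu 1) (hvu 2), hσ u hu _ _ (hvu 0) (hvu 2), hσ u hu _ _ (hvu 0) (hvu 1), hB,
      hB, hB]
    exact h
  · intro u hu v hv hker w hw
    rw [ContinuousLinearMap.fderiv, hB, hB, stdSymplecticForm_swap (L v) (L w), ← hσ u hu v w hv hw,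
      hker w hw]
    ring

/-! ### The seam of the witness -/

/-- A point of the round 2-sphere and its antipode differ. [folklore] -/
private theorem northPole_ne_neg :
    (⟨EuclideanSpace.single 0 1, by simp⟩ : Metric.sphere (0 : EuclideanSpace ℝ (Fin 3)) 1) ≠
      -⟨EuclideanSpace.single 0 1, by simp⟩ :=
  ne_neg_of_mem_unit_sphere ℝ _

section Witness

variable {e : EuclideanSpace ℝ (Fin 4) → Metric.sphere (0 : EuclideanSpace ℝ (Fin 5)) 1}
  {π : Metric.sphere (0 : EuclideanSpace ℝ (Fin 5)) 1 → EuclideanSpace ℝ (Fin 4)}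
  {U : Set (Metric.sphere (0 : EuclideanSpace ℝ (Fin 5)) 1)}
  {L : EuclideanSpace ℝ (Fin 4) ≃ₗᵢ[ℝ] EuclideanSpace ℝ (Fin 4)}
  {G : EuclideanSpace ℝ (Fin 4) → SphereProdFour}
  (hU : IsOpen U) (hDU : (e '' ball (0 : EuclideanSpace ℝ (Fin 4)) 1)ᶜ ⊆ U)
  (hπs : ContMDiffOn (𝓡 4) (𝓡 4) ∞ π U) (hπi : InjOn π U)
  (hπd : ∀ x ∈ U, Bijective (mfderiv (𝓡 4) (𝓡 4) π x))
  (hπU : MapsTo π U (ball (0 : EuclideanSpace ℝ (Fin 4)) 2))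
  (hseam : ∀ u : EuclideanSpace ℝ (Fin 4), ‖u‖ = 1 → π (e u) = L u ∧
    MDifferentiableAt (𝓡 4) (𝓡 4) (π ∘ e) u ∧
    ∀ v : EuclideanSpace ℝ (Fin 4), ⟪v, u⟫ = 0 → mfderiv (𝓡 4) (𝓡 4) (π ∘ e) u v = L v)
  (hGs : ContMDiffOn (𝓡 4) (𝓡 4) ∞ G (ball 0 2)) (hGi : InjOn G (ball 0 2))
  (hGd : ∀ z ∈ ball (0 : EuclideanSpace ℝ (Fin 4)) 2, Bijective (mfderiv (𝓡 4) (𝓡 4) G z))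
  (hGσ : ∀ z ∈ ball (0 : EuclideanSpace ℝ (Fin 4)) 2, ∀ a b : EuclideanSpace ℝ (Fin 4),
    sphereProdFourForm (G z) ![mfderiv (𝓡 4) (𝓡 4) G z a, mfderiv (𝓡 4) (𝓡 4) G z b] =
      stdSymplecticForm a b)

include hU hDU hπs hπi hπd hπU hGs hGi hGd in
/-- **`J = G ∘ π` embeds a neighbourhood of the fake ball** `S⁴ ∖ e(B⁴)`: on `U` it is `C^∞`,
injective and has bijective differential (chain rule). [folklore] -/
private theorem embedsFakeBallNhd_witness :
    ∃ U : Set (Metric.sphere (0 : EuclideanSpace ℝ (Fin 5)) 1), IsOpen U ∧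
      (e '' Metric.ball (0 : EuclideanSpace ℝ (Fin 4)) 1)ᶜ ⊆ U ∧
      ContMDiffOn (𝓡 4) (𝓡 4) ∞ (fun x => G (π x)) U ∧ Set.InjOn (fun x => G (π x)) U ∧
      ∀ x ∈ U, Function.Bijective (mfderiv (𝓡 4) (𝓡 4) (fun x => G (π x)) x) := by
  refine ⟨U, hU, hDU, hGs.comp hπs hπU, hGi.comp hπi hπU, fun x hx => ?_⟩
  have hπx : MDifferentiableAt (𝓡 4) (𝓡 4) π x :=
    (hπs.contMDiffAt (hU.mem_nhds hx)).mdifferentiableAt (by simp)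
  have hGx : MDifferentiableAt (𝓡 4) (𝓡 4) G (π x) :=
    (hGs.contMDiffAt (isOpen_ball.mem_nhds (hπU hx))).mdifferentiableAt (by simp)
  have hcomp : mfderiv (𝓡 4) (𝓡 4) (fun x => G (π x)) x =
      (mfderiv (𝓡 4) (𝓡 4) G (π x)).comp (mfderiv (𝓡 4) (𝓡 4) π x) := mfderiv_comp x hGx hπx
  rw [hcomp]
  exact (hGd _ (hπU hx)).comp (hπd x hx)

include hseam hGs hGσ in
/-- **The seam trace of the witness is the round contact trace transported by `L`**: for
`‖u‖ = 1` and `v, w ⊥ u`,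
`Ω((J ∘ e) u)(d(J ∘ e) v, d(J ∘ e) w) = (G^*Ω)_{Lu}(L v, L w) = ω₀(L v, L w)`. [folklore] -/
private theorem seamTrace_witness {u : EuclideanSpace ℝ (Fin 4)} (hu : ‖u‖ = 1)
    (v w : EuclideanSpace ℝ (Fin 4)) (hv : ⟪v, u⟫ = 0) (hw : ⟪w, u⟫ = 0) :
    sphereProdFourForm (((fun x => G (π x)) ∘ e) u)
      ![mfderiv (𝓡 4) (𝓡 4) ((fun x => G (π x)) ∘ e) u v,
        mfderiv (𝓡 4) (𝓡 4) ((fun x => G (π x)) ∘ e) u w] = stdSymplecticForm (L v) (L w) := by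
  obtain ⟨hpt, hd, hdv⟩ := hseam u hu
  have hLu : L u ∈ ball (0 : EuclideanSpace ℝ (Fin 4)) 2 := by
    rw [mem_ball_zero_iff, L.norm_map, hu]; norm_num
  have hGd' : MDifferentiableAt (𝓡 4) (𝓡 4) G ((π ∘ e) u) := by
    rw [show (π ∘ e) u = L u from hpt]
    exact (hGs.contMDiffAt (isOpen_ball.mem_nhds hLu)).mdifferentiableAt (by simp)
  have hcomp : mfderiv (𝓡 4) (𝓡 4) ((fun x => G (π x)) ∘ e) u =
      (mfderiv (𝓡 4) (𝓡 4) G ((π ∘ e) u)).comp (mfderiv (𝓡 4) (𝓡 4) (π ∘ e) u) :=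
    mfderiv_comp u hGd' hd
  rw [hcomp]
  show sphereProdFourForm (G ((π ∘ e) u))
    ![mfderiv (𝓡 4) (𝓡 4) G ((π ∘ e) u) (mfderiv (𝓡 4) (𝓡 4) (π ∘ e) u v),
      mfderiv (𝓡 4) (𝓡 4) G ((π ∘ e) u) (mfderiv (𝓡 4) (𝓡 4) (π ∘ e) u w)] = _
  rw [hdv v hv, hdv w hw, show (π ∘ e) u = L u from hpt]
  exact hGσ (L u) hLu (L v) (L w)

end Witness

/-! ### The registered helper -/

/-- **The hypothesis package of STUB 3 v2 is inhabited at `S = S⁴`** (non-vacuity; the known rung of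
the line): take `S = S⁴` with its genuine chart ball `e = (chartAt q)⁻¹`, the host
`(X, Ω) = (S² × S², σ ⊕ σ)` charted on `ℝ⁴` with its square-zero symplectic sphere pair
(`sphereProdFour_hostPackage`), and `J = G ∘ π` — the symplectic Darboux ball `G : B⁴(2) → S² × S²`
(product of Archimedes charts) composed with the rescaled antipodal chart `π`; then `J` embeds a
neighbourhood of the fake ball `S⁴ ∖ e(B⁴)`, and the seam `J ∘ e|_{S³}` is the round contact
sphere up to a linear isometry `L` of `ℝ⁴` (`σ(u)(v, w) = ω₀(L v, L w)` on `u^⊥`), which the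
transported contact form `θ(u) = ½ ω₀(L u, L ·)` stabilises (Cieliebak–Volkov: the contact case of
a stable Hamiltonian structure; `helper_isStabilising_roundContactSphere`). [folklore] -/
theorem helper_stableSeamHypotheses_inhabited :
    ∃ (S : Literature.Topology.FourManifolds.HomotopySphere 4) (e : EuclideanSpace ℝ (Fin 4) → S.carrier) (X : Type) (_ : TopologicalSpace X) (_ : T2Space X) (_ : SecondCountableTopology X) (_ : CompactSpace X) (_ : ChartedSpace (EuclideanSpace ℝ (Fin 4)) X) (_ : IsManifold (𝓡 4) ∞ X) (_ : SimplyConnectedSpace X) (Ω : Literature.Geometry.Kaehler.MForm (𝓡 4) X ℝ 2) (J : S.carrier → X) (θ : EuclideanSpace ℝ (Fin 4) → EuclideanSpace ℝ (Fin 4) →L[ℝ] ℝ), Nonempty (S.carrier ≃ₘ⟮𝓡 4, 𝓡 4⟯ Metric.sphere (0 : EuclideanSpace ℝ (Fin 5)) 1) ∧ Manifold.IsSmoothEmbedding (𝓡 4) (𝓡 4) ∞ e ∧ (Literature.Geometry.Kaehler.IsSmoothForm Ω ∧ Literature.Geometry.Kaehler.IsClosedForm Ω ∧ ∀ x (v :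 TangentSpace (𝓡 4) x), v ≠ 0 → ∃ w, Ω x ![v, w] ≠ 0) ∧ (∃ U : Set S.carrier, IsOpen U ∧ (e '' Metric.ball (0 : EuclideanSpace ℝ (Fin 4)) 1)ᶜ ⊆ U ∧ ContMDiffOn (𝓡 4) (𝓡 4) ∞ J U ∧ Set.InjOn J U ∧ ∀ x ∈ U, Function.Bijective (mfderiv (𝓡 4) (𝓡 4) J x)) ∧ ((∃ c c' : (Metric.sphere (0 : EuclideanSpace ℝ (Fin 3)) 1) → X, (Manifold.IsSmoothEmbedding (𝓡 2) (𝓡 4) ∞ c ∧ (∀ y (v : TangentSpace (𝓡 2) y), v ≠ 0 → ∃ w : TangentSpace (𝓡 2) y, Ω (c y) ![mfderiv (𝓡 2) (𝓡 4) c y v, mfderiv (𝓡 2) (𝓡 4) c y w] ≠ 0) ∧ Manifold.IsSmoothEmbedding (𝓡 2) (𝓡 4) ∞ c' ∧ Disjoint (Set.range c) (Set.range c') ∧ ∃ H : unitInterval × (Metric.sphere (0 : EuclideanSpace ℝ (Fin 3)) 1) → X, Continuous H ∧ ∀ y, H (0, y) = c y ∧ H (1, y) = c' y)) ∨ (∃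 (Ψ : X ≃ₘ⟮𝓡 4, 𝓡 4⟯ Literature.Topology.FourManifolds.ComplexProjectivePlane) (a : ℝ), 0 < a ∧ ∀ x (v w : TangentSpace (𝓡 4) x), Ω x ![v, w] = a * Literature.Geometry.Kaehler.CPn.fsForm 2 (Ψ x) ![mfderiv (𝓡 4) (𝓡 4) Ψ x v, mfderiv (𝓡 4) (𝓡 4) Ψ x w])) ∧ (ContDiff ℝ ∞ θ ∧ (∀ u : EuclideanSpace ℝ (Fin 4), ‖u‖ = 1 → ∀ v : Fin 3 → EuclideanSpace ℝ (Fin 4), (∀ i, ⟪v i, u⟫ = 0) → LinearIndependent ℝ v → θ u (v 0) * Ω ((J ∘ e) u) ![mfderiv (𝓡 4) (𝓡 4) (J ∘ e) u (v 1), mfderiv (𝓡 4) (𝓡 4) (J ∘ e) u (v 2)] - θ u (v 1) * Ω ((J ∘ e) u) ![mfderiv (𝓡 4) (𝓡 4) (J ∘ e) u (v 0), mfderiv (𝓡 4) (𝓡 4) (J ∘ e) u (v 2)] + θ u (v 2) * Ω ((J ∘ e) u) ![mfderiv (𝓡 4) (𝓡 4) (J ∘ e) u (v 0), mfderiv (𝓡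 4) (𝓡 4) (J ∘ e) u (v 1)] ≠ 0) ∧ (∀ u : EuclideanSpace ℝ (Fin 4), ‖u‖ = 1 → ∀ v : EuclideanSpace ℝ (Fin 4), ⟪v, u⟫ = 0 → (∀ w : EuclideanSpace ℝ (Fin 4), ⟪w, u⟫ = 0 → Ω ((J ∘ e) u) ![mfderiv (𝓡 4) (𝓡 4) (J ∘ e) u v, mfderiv (𝓡 4) (𝓡 4) (J ∘ e) u w] = 0) → ∀ w : EuclideanSpace ℝ (Fin 4), ⟪w, u⟫ = 0 → fderiv ℝ θ u v w - fderiv ℝ θ u w v = 0)) := by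
  obtain ⟨o⟩ := isOrientable_of_homotopyEquiv_sphere_four_holds
    (Metric.sphere (0 : EuclideanSpace ℝ (Fin 5)) 1) (ContinuousMap.HomotopyEquiv.refl _)
  obtain ⟨e, π, U, L, he, hU, hDU, hπs, hπi, hπd, hπU, hseam⟩ := helper_antipodalChartPair
  obtain ⟨G, hGs, hGi, hGd, hGσ⟩ := helper_darbouxBall_sphereProdFour
  haveI : Fact (Module.finrank ℝ (EuclideanSpace ℝ (Fin 3)) = 2 + 1) := ⟨finrank_euclideanSpace_fin⟩
  have hpkg := sphereProdFour_hostPackage northPole_ne_neg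
  obtain ⟨θ, hθ⟩ := isStabilising_transfer L
    (σ := fun u v w => sphereProdFourForm (((fun x => G (π x)) ∘ e) u)
      ![mfderiv (𝓡 4) (𝓡 4) ((fun x => G (π x)) ∘ e) u v,
        mfderiv (𝓡 4) (𝓡 4) ((fun x => G (π x)) ∘ e) u w])
    (fun u hu v w hv hw => seamTrace_witness hseam hGs hGσ hu v w hv hw)
  exact ⟨⟨Metric.sphere (0 : EuclideanSpace ℝ (Fin 5)) 1, o, ⟨.refl _⟩⟩, e, SphereProdFour,
    inferInstance, inferInstance, inferInstance, inferInstance, inferInstance, inferInstance,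
    inferInstance, sphereProdFourForm, fun x => G (π x), θ, ⟨Diffeomorph.refl _ _ _⟩, he, hpkg.1,
    embedsFakeBallNhd_witness hU hDU hπs hπi hπd hπU hGs hGi hGd, Or.inl ⟨_, _, hpkg.2⟩, hθ⟩

end Summit.SmoothPoincare4.SmoothPoincare4.Theorems.OrigamiFoldExistence.StableSeamHost

end
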